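import Summits.CriticalPhenomena.SAWScalingLimit.Theorems.SAWLoopFugacityFlowSimpleSubseqLimitsPSStubDecompositionClock
import Literature.Probability.RandomPlanarGeometry.Curve
import HarnessLib

/-!
# Line `past-shadowing-costs-halves` (crux `SAWLoopFugacityFlow.SimpleSubseqLimits`, stmt-CriticalPhenomena-4982),
stub `stub_decomposition` — part 2: the deterministic core

If a curve `ε`-nearly `(η, ρ)`-shadows its past (`NearShadows`, verbatim the skeleton's) while its
initial piece up to time `T` stays in the open ball `B(a, r₀)` and `r₀ + ε < η/4`, then it does so
FROM time `T` with an `η/4`-stretch: the configuration's past-threshold `s₀` is `≥ T`, and the initial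
(or final) piece of the stretch cut at its first entrance into (last exit from) `B̄(a, r₀ + ε)` has
displacement `> η/4` and shadows only past points at times `> T` (`nearShadowsFrom_of_prefix_ball`).
Transported along the dyadic tail clock of part 1 this is a near-shadowing of the `k`-th TAIL
curve (`nearShadows_of_comp_dyadic`).
-/

noncomputable section

open Set Metric
open scoped unitInterval Topology

namespace Summit.CriticalPhenomena.SAWScalingLimit.Theorems.SimpleSubseqLimits.PastShadowing.Core

open Literature.Probability.RandomPlanarGeometry
open Summit.CriticalPhenomena.SAWScalingLimit.Theorems.SimpleSubseqLimits.PastShadowing.Clock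
open Literature.Probability.RandomPlanarGeometry (dyadicTime)

/-- Lattice-visible **`ε`-near shadowing** (VERBATIM the skeleton's `NearShadows`): after `s₀`, a
stretch of displacement `> η` stays within (open) distance `ε` of past points at distance `> ρ` from
`γ s₀`. [folklore] -/
def NearShadows (γ : Curve ℂ) (η ρ ε : ℝ) : Prop :=
  ∃ s₀ t t' : I, s₀ ≤ t ∧ t ≤ t' ∧ η < dist (γ t) (γ t') ∧
    ∀ u : I, t ≤ u → u ≤ t' → ∃ v : I, v ≤ s₀ ∧ ρ < dist (γ v) (γ s₀) ∧ dist (γ u) (γ v) < ε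

/-- Near shadowing FROM a time threshold `T`: as `NearShadows`, with `T ≤ s₀` and all shadowed past
points at times `≥ T`. [folklore] -/
def NearShadowsFrom (γ : Curve ℂ) (T : I) (η ρ ε : ℝ) : Prop :=
  ∃ s₀ t t' : I, T ≤ s₀ ∧ s₀ ≤ t ∧ t ≤ t' ∧ η < dist (γ t) (γ t') ∧
    ∀ u : I, t ≤ u → u ≤ t' → ∃ v : I, T ≤ v ∧ v ≤ s₀ ∧ ρ < dist (γ v) (γ s₀) ∧ dist (γ u) (γ v) < ε

/-- Step A of the core: a stretch point at distance `≥ r₀ + ε` from `a` can only shadow a past point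
at distance `> r₀` from `a`, hence not one of the prefix (times `≤ T`, inside `B(a, r₀)`).
[folklore] -/
theorem lt_of_shadow_far {γ : Curve ℂ} {a : ℂ} {r₀ ε : ℝ} {T u v : I}
    (hpre : ∀ s : I, s ≤ T → dist (γ s) a < r₀) (hu : r₀ + ε ≤ dist (γ u) a)
    (huv : dist (γ u) (γ v) < ε) : T < v := by
  by_contra hv
  have h1 := hpre v (not_lt.1 hv)
  have h2 : dist (γ u) a ≤ dist (γ u) (γ v) + dist (γ v) a := dist_triangle _ _ _
  linarith

/-- **The deterministic core of the decomposition.** If `γ` `ε`-nearly `(η, ρ)`-shadows its past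
and its initial piece up to time `T` lies in the open ball `B(a, r₀)` with `0 < ε`, `r₀ + ε < η / 4`, then
`γ` `ε`-nearly `(η/4, ρ)`-shadows its past FROM `T`. Proof: `s₀ ≥ T` (else the whole stretch is
within `r₀ + ε` of `a` and has displacement `< η`); one endpoint of the stretch is at distance
`> η/2` from `a`; cut the stretch at its first entrance into / last exit from `B̄(a, r₀ + ε)` on that
side (or keep it whole if it misses the closed ball): the piece has displacement `> η/2 - (r₀+ε)
> η/4`, all its points are at distance `≥ r₀ + ε` from `a`, so (Step A) shadow only past points at
times `> T`. [folklore] -/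
theorem nearShadowsFrom_of_prefix_ball {γ : Curve ℂ} {a : ℂ} {r₀ ε η ρ : ℝ} {T : I}
    (hpre : ∀ s : I, s ≤ T → dist (γ s) a < r₀) (hε : 0 < ε) (hr : r₀ + ε < η / 4)
    (h : NearShadows γ η ρ ε) : NearShadowsFrom γ T (η / 4) ρ ε := by
  obtain ⟨s₀, t, t', hs₀t, htt', hdisp, hall⟩ := h
  have hr₀ : 0 < r₀ := lt_of_le_of_lt dist_nonneg (hpre T le_rfl)
  -- Step B: `T ≤ s₀`
  have hTs₀ : T ≤ s₀ := by
    by_contra hlt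
    push Not at hlt
    have hclose : ∀ u : I, t ≤ u → u ≤ t' → dist (γ u) a < r₀ + ε := by
      intro u hu hu'
      obtain ⟨v, hv, -, huv⟩ := hall u hu hu'
      have h1 := hpre v (hv.trans hlt.le)
      linarith [dist_triangle (γ u) (γ v) a]
    have h1 := hclose t le_rfl htt'
    have h2 := hclose t' htt' le_rfl
    have h3 : dist (γ t) (γ t') ≤ dist (γ t) a + dist (γ t') a := dist_triangle_right _ _ _
    linarith
  -- the closed set of stretch times inside `B̄(a, r₀ + ε)`
  set B : Set I := {u | t ≤ u ∧ u ≤ t' ∧ dist (γ u) a ≤ r₀ + ε} with hB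
  have hBc : IsClosed B := by
    have h1 : IsClosed {u : I | t ≤ u} := isClosed_le continuous_const continuous_id
    have h2 : IsClosed {u : I | u ≤ t'} := isClosed_le continuous_id continuous_const
    have h3 : IsClosed {u : I | dist (γ u) a ≤ r₀ + ε} :=
      isClosed_le (γ.continuous.dist continuous_const) continuous_const
    have : B = {u : I | t ≤ u} ∩ ({u : I | u ≤ t'} ∩ {u : I | dist (γ u) a ≤ r₀ + ε}) := by
      ext u; simp [hB]
    rw [this]
    exact h1.inter (h2.inter h3)
  have hBk : IsCompact B := hBc.isCompact
  -- the generic conclusion from a good sub-stretch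
  have conclude : ∀ p q : I, s₀ ≤ p → p ≤ q → t ≤ p → q ≤ t' → η / 4 < dist (γ p) (γ q) →
      (∀ u : I, p ≤ u → u ≤ q → r₀ + ε ≤ dist (γ u) a) → NearShadowsFrom γ T (η / 4) ρ ε := by
    intro p q hsp hpq htp hqt hd hfar
    refine ⟨s₀, p, q, hTs₀, hsp, hpq, hd, fun u hu hu' => ?_⟩
    obtain ⟨v, hv, hρv, huv⟩ := hall u (htp.trans hu) (hu'.trans hqt)
    exact ⟨v, (lt_of_shadow_far hpre (hfar u hu hu') huv).le, hv, hρv, huv⟩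
  by_cases hBne : B.Nonempty
  · -- endpoint dichotomy
    have hsum : η < dist (γ t) a + dist (γ t') a :=
      hdisp.trans_le (dist_triangle_right _ _ _)
    rcases lt_or_ge (η / 2) (dist (γ t) a) with ht_far | ht_near
    · -- cut at the first entrance `t₁`
      obtain ⟨t₁, ht₁B, ht₁min⟩ := hBk.exists_isLeast hBne
      obtain ⟨ht₁t, ht₁t', ht₁d⟩ := ht₁B
      have htt₁ : t < t₁ := by
        rcases ht₁t.lt_or_eq with h | h
        · exact h
        · exfalso; rw [← h] at ht₁d; linarith
      have hfar : ∀ u : I, t ≤ u → u < t₁ → r₀ + ε < dist (γ u) a := by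
        intro u hu hut₁
        by_contra hle
        push Not at hle
        exact absurd (ht₁min ⟨hu, hut₁.le.trans ht₁t', hle⟩) (not_le.2 hut₁)
      -- at `t₁` itself the distance is `≥ r₀ + ε` by continuity from the left
      have ht₁ge : r₀ + ε ≤ dist (γ t₁) a := by
        have hcl : IsClosed {u : I | r₀ + ε ≤ dist (γ u) a} :=
          isClosed_le continuous_const (γ.continuous.dist continuous_const)
        have hsub : Ico t t₁ ⊆ {u : I | r₀ + ε ≤ dist (γ u) a} := fun u hu => (hfar u hu.1 hu.2).le
        have hmem : t₁ ∈ closure (Ico t t₁) := by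
          rw [closure_Ico htt₁.ne]; exact right_mem_Icc.2 htt₁.le
        exact closure_minimal hsub hcl hmem
      refine conclude t t₁ hs₀t htt₁.le le_rfl ht₁t' ?_ fun u hu hu' => ?_
      · have := abs_dist_sub_le (γ t) (γ t₁) a
        have h2 : dist (γ t) a - dist (γ t₁) a ≤ dist (γ t) (γ t₁) := by
          linarith [dist_triangle (γ t) (γ t₁) a]
        linarith
      · rcases hu'.lt_or_eq with h | h
        · exact (hfar u hu h).le
        · rw [h]; exact ht₁ge
    · -- then the far endpoint is `t'`: cut at the last exit `t₂`
      have ht'_far : η / 2 < dist (γ t') a := by linarith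
      obtain ⟨t₂, ht₂B, ht₂max⟩ := hBk.exists_isGreatest hBne
      obtain ⟨ht₂t, ht₂t', ht₂d⟩ := ht₂B
      have ht₂t'lt : t₂ < t' := by
        rcases ht₂t'.lt_or_eq with h | h
        · exact h
        · exfalso; rw [h] at ht₂d; linarith
      have hfar : ∀ u : I, t₂ < u → u ≤ t' → r₀ + ε < dist (γ u) a := by
        intro u hut₂ hu
        by_contra hle
        push Not at hle
        exact absurd (ht₂max ⟨ht₂t.trans hut₂.le, hu, hle⟩) (not_le.2 hut₂)
      have ht₂ge : r₀ + ε ≤ dist (γ t₂) a := by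
        have hcl : IsClosed {u : I | r₀ + ε ≤ dist (γ u) a} :=
          isClosed_le continuous_const (γ.continuous.dist continuous_const)
        have hsub : Ioc t₂ t' ⊆ {u : I | r₀ + ε ≤ dist (γ u) a} := fun u hu => (hfar u hu.1 hu.2).le
        have hmem : t₂ ∈ closure (Ioc t₂ t') := by
          rw [closure_Ioc ht₂t'lt.ne]; exact left_mem_Icc.2 ht₂t'lt.le
        exact closure_minimal hsub hcl hmem
      refine conclude t₂ t' (hs₀t.trans ht₂t) ht₂t'lt.le ht₂t le_rfl ?_ fun u hu hu' => ?_
      · have h2 : dist (γ t') a - dist (γ t₂) a ≤ dist (γ t₂) (γ t') := by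
          linarith [dist_triangle (γ t') (γ t₂) a, dist_comm (γ t') (γ t₂)]
        linarith
      · rcases hu.lt_or_eq with h | h
        · exact (hfar u h hu').le
        · rw [← h]; exact ht₂ge
  · -- the stretch misses the closed ball entirely
    have hfar : ∀ u : I, t ≤ u → u ≤ t' → r₀ + ε ≤ dist (γ u) a := by
      intro u hu hu'
      by_contra hlt
      push Not at hlt
      exact hBne ⟨u, hu, hu', hlt.le⟩
    have hη : η / 4 < η := by linarith [hr, hr₀]
    exact conclude t t' hs₀t htt' le_rfl le_rfl (hη.trans hdisp) hfar

/-- **Registered anchor `stub_decompositionCore`** of this support file (the core with the time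
threshold forgotten): prefix inside `B(a, r₀)` up to `T`, `0 < ε`, `r₀ + ε < η/4`, `ε`-near
`(η, ρ)`-shadowing ⇒ `ε`-near `(η/4, ρ)`-shadowing. [folklore] -/
theorem stub_decompositionCore :
    ∀ (γ : Curve ℂ) (a : ℂ) (r₀ ε η ρ : ℝ) (T : I), (∀ s : I, s ≤ T → dist (γ s) a < r₀) →
      0 < ε → r₀ + ε < η / 4 → NearShadows γ η ρ ε → NearShadows γ (η / 4) ρ ε := by
  intro γ a r₀ ε η ρ T hpre hε hr h
  obtain ⟨s₀, t, t', -, h1, h2, h3, h4⟩ := nearShadowsFrom_of_prefix_ball hpre hε hr h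
  exact ⟨s₀, t, t', h1, h2, h3, fun u hu hu' => by
    obtain ⟨v, -, hv, hρ, hd⟩ := h4 u hu hu'
    exact ⟨v, hv, hρ, hd⟩⟩

/-- **Transport along the dyadic tail clock.** If `γ' τ = γ (1 - 2^{-k} + 2^{-k} τ)` and `γ`
near-shadows its past from `dyadicTime k`, then `γ'` near-shadows its past (all times
`≥ dyadicTime k` are clock values, the clock is strictly monotone). [folklore] -/
theorem nearShadows_of_comp_dyadic {γ γ' : Curve ℂ} {k : ℕ} {η ρ ε : ℝ}
    (hγ' : ∀ τ : I, γ' τ = γ ⟨_, dyadic_mem k τ⟩) (h : NearShadowsFrom γ (dyadicTime k) η ρ ε) :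
    NearShadows γ' η ρ ε := by
  obtain ⟨s₀, t, t', hT, hs₀t, htt', hdisp, hall⟩ := h
  obtain ⟨a₀, rfl⟩ := exists_dyadic_eq hT
  obtain ⟨b, rfl⟩ := exists_dyadic_eq (hT.trans hs₀t)
  obtain ⟨b', rfl⟩ := exists_dyadic_eq ((hT.trans hs₀t).trans htt')
  have hsm := dyadic_strictMono k
  refine ⟨a₀, b, b', hsm.le_iff_le.1 hs₀t, hsm.le_iff_le.1 htt', by rwa [hγ', hγ'], ?_⟩
  intro u hu hu'
  obtain ⟨v, hvT, hv, hρ, hd⟩ := hall ⟨_, dyadic_mem k u⟩ (hsm.monotone hu) (hsm.monotone hu')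
  obtain ⟨v', rfl⟩ := exists_dyadic_eq hvT
  refine ⟨v', hsm.le_iff_le.1 hv, ?_, ?_⟩
  · rwa [hγ', hγ']
  · rwa [hγ', hγ']

end Summit.CriticalPhenomena.SAWScalingLimit.Theorems.SimpleSubseqLimits.PastShadowing.Core

end
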